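import Literature.MathematicalPhysics.QuantumFieldTheory.Balaban1983to89.B9Eq3104CommutatorSizes
import Literature.MathematicalPhysics.QuantumFieldTheory.Balaban1983to89.B9GradViaDivLettersAtPins
import Literature.MathematicalPhysics.QuantumFieldTheory.Balaban1983to89.B9Thm37CutoffDivTerms
import Literature.MathematicalPhysics.QuantumFieldTheory.Balaban1983to89.Node00.OpsYRead342Cross

/-!
# `Balaban1983to89.B9Thm310TransposedCommutatorBForms` — T. Bałaban, *Propagators for lattice gauge theories in a background field*, Commun. Math.
# Phys. **99** (1985) 389–434 [Balaban1985BackgroundPropagators], Sect. C pp. 413–415: THE CUT-OFF COMMUTATOR `K(h)(U) = [h, Δ_loc(U)]` OF THE BOND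
# SECTOR ((3.104)) REGROUPED FOR AN OPERATOR ACTING ON ITS LEFT — every first-order piece written as a componentwise adjoint derivative `∇*_{U,μ}` ((3.8)) of
# an explicit small bond function, plus explicit zeroth-order remainders (second differences of `h`, plaquette-holonomy defects, the defect `𝒦_U − 1` of the
# Jordan insertion of (3.10)), so that the TRANSPOSED family `h_□G_□(U)K(h_□)` of (3.105) can be bounded through `G_□∇*_U` ((3.42)₃) and `G_□` ((3.42)₁)
# (sub-row G-B9-LETTERS, module M5.7, PLAN item 5 «hV», file T1 = algebra; the bond-sector twin of `B9Thm37TransposedCommutator` §1)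

statement-level skeleton of published theorems with citation tags; proofs where landed; nothing here is a claim about the Yang–Mills mass gap

PDF held: `paper:balaban1985-cmp99-background-propagators` (journal page = PDF page + 388); pp. 390–392, 409, 413–415 read from the held text layer.

THE PRINT.  (3.3) p. 390 *«(D_Uλ)(b) = η⁻¹(U(b)λ(b₊) − λ(b₋))»*; (3.8) p. 392 (the adjoint derivatives `D*`); (3.4)–(3.5) p. 391 and (3.9)–(3.10) p. 392 (the covariant
curl, its adjoint on plaquette functions, `Δ(U) = D*𝒦D + Δ′` through the insertion of `Re U(∂p)`); (3.7) p. 391 *«U(∂p) = U(x,y)U(y,z)U(z,w)U(w,x)»*;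
p. 413 (3.100) *«(D_μ hA_ν)(x) = h(x)(D_μA_ν)(x) + (∂_μh)(x)R(U(x, x+ηe_μ))A_ν(x+ηe_μ), similarly for adjoint derivatives, hence the commutators [D*D, h] and
[DD*, h] are first order differential operators with coefficients determined by derivatives of the function h»*; p. 414 l. 1–3 *«They are of the order
O(M⁻¹), or O(M⁻²), if considered on a proper scale. The operator Δ′ is small and local by (3.10), hence the commutator [Δ′, h] gives the factor O(M⁻¹) too»*;
(3.104) *«Δ_a hA = hΔ_a A − K(h)A − P₁(∂h)A»*; (3.105) p. 414 (the expansion `Δ_aG₀ = I − R`) and p. 415 *«we use again the flexibility of these expansions»*;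
p. 398 (remark after (3.47)) *«we may always replace ∇_U by ∇*_U … in arbitrary place»*; (3.42) p. 397 (first and third members: `|G(U)|`, `|G(U)∇*_U|`).

WHY THIS FILE (cell context).  M5.7's right-entry reading of Thm 3.3 (3.42)₃ for `G(U)` (`B9Thm310GTorusRegularEntries.hasMajorant_right_conj_GAY_of_cubes`,
`…CoverCubes.eBlock_kernelFamilyBInv_GAY_of_coverCubes`) runs through the TRANSPOSED (3.105), `(Σ_□h_□G_□h_□)Δ_a = 1 − V`, and displays the scale-weighted
majorant of `V` (`hV`).  Its first family is `−Σ_□ h_□G_□(U)K(h_□)(U)`: the commutator now acts BEFORE the cube letter, so the bound of (3.89) must be obtained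
with every difference of the argument moved onto `G_□` — i.e. through `G_□∇*_{U,μ}` ((3.42)₃, componentwise `∇*` on bond functions, def-Y's `cdsB`) or through
`G_□` itself ((3.42)₁) for terms already carrying a second difference of `h_□` or a small holonomy factor.  def-Y's `K(h) = [h, D*𝒦D] + [h, Δ′₂] + [h, DD*] +
[h, Q*aQ]` (`B9Eq3104CommutatorSizes.KhBY_eq_four`) is built from the EXTERIOR letters; this file rewrites its four first-order pieces, bond by bond, as
`Σ_μ ∇*_{U,μ}(explicit bond function)(b) + (explicit zeroth-order terms)(b)`:
* `D*𝒦([h]D)Λ = Σ_μ ∇*_μ(dCurl_μ)` EXACTLY ((3.9) through components, `B9Eq3104CommutatorGradFormCurl.coCurlY_apply_eq`);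
* `D([h]D*)Λ = Σ_μ ∇*_μ(J_μ dDiv)` EXACTLY (n06-l's `B9GradViaDivLettersAtPins.gradY_apply_eq_sum_cdsB_Jb`, `D_U = Σ_μ ∇*_{U,μ}∘J_μ`);
* `([h]D*)(𝒦DΛ)`: the far plaquette's transporter carried round the corner ((3.7): `B9Eq3104CommutatorGradFormDD.transport_corner`), `∇_μΛ_ν(x−e_μ) =
  −R(U_μ(x−e_μ))∇*_μΛ_ν(x)` ((3.5)), `𝒦 = 1 + (𝒦 − 1)`: `Σ_μ ∇*_μ(dMul_μ) + Σ_μΣ_λ ∇*_λ(J_λ dBwd_μ)` plus the remainders `zSec` (second difference of `h`),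
  `zMixB` (mixed second difference), `zHolB` (holonomy defect `Y − R(U(∂p))Y`), `zJor` (the insertion defect `(𝒦 − c_f)(D_UΛ)`);
* `([h]D)(D*Λ)`: `Σ_μ ∇*_μ(dFwd_μ)` plus `zMixF`, `zHolF`;
and leaves `[h, Δ′₂]Λ` and `[h, Q*aQ]Λ` (zeroth order already) as they are: ★★ `KhBY_apply_transposed`.
Nothing is estimated here (file T2 `B9Thm310TransposedCommutatorB` sizes every term; file T3 feeds M5.7's `hV`).  Nothing of Thm 3.10 ∕ 3.3 asserted;
nothing continuum ∕ OS ∕ mass gap ∕ Clay; YM mass gap NOT proved by any of this (Track A conditional rung).  `--supports stmt-QuantumFields-19200`.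
Net new unproved facts: 0 (definitions with bodies + theorems only).

WHAT IS PROVED.  §1 `dg`, `fwdT`, `bwdT` (+ `_apply`); §2 `smul_cdS_eq`, `R_inv_cdS_symm_eq`, `R_inv_cdS_cross_eq`, `R_cdsS_shift_eq`, `cdsS_sub_apply`,
`cdsS_smul_apply`, `cdS_smul_apply`; §3 `extP_cutMulY_hPlY`, `extP_sub`, `extP_curlY'`, `extP_jordan_curlY`, `curlCommComp`, `extP_jordan_curlComm`;
§4 `dCurl`, `coCurl_jordan_curlComm_apply`; `dDiv`, `divComm_apply`, `grad_divComm_apply`; `coCurlComm_apply`, `dMul`, `dBwd`, `zSec`, `zMixB`, `zHolB`,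
`zJor`, `coCurlComm_jordan_curl_apply`; `dFwd`, `zMixF`, `zHolF`, `gradComm_div_apply`; §5 ★★ `KhBY_apply_transposed`.
-/

noncomputable section

namespace Literature.MathematicalPhysics.QuantumFieldTheory.Balaban1983to89.B9Thm310TransposedCommutatorBForms

open Node00
open B9Thm37CubeCoverCommutators (cutMulY cutMulY_apply cdS_cutMulY_apply)
open B9Thm37CutoffDivTerms (cutMulY_cdsS_eq)
open B9Eq3104CutoffCommutators (cutCommR cutCommR_apply hBdY hBdY_apply hPlY hPlY_apply KhBY cutCommR_coCurl_jordan_curl cutCommR_gradY_divY)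
open B9Eq3104CommutatorSizes (KhBY_eq_four)
open B9Eq3104CommutatorGradFormDD (shiftY_symm_shiftY_comm shiftY_shiftY_symm shiftY_symm_shiftY transport_corner bondCompY_cutMulY cdB_eq_cdS_bondCompY
  cdsB_eq_cdsS_bondCompY)
open B9Eq3104CommutatorGradFormCurl (extP extP_chartY extP_curlY extP_jordanY coCurlY_apply_eq)
open B9Eq3104CommutatorSizesCurl (jIns)
open B9GradViaDivLettersAtPins (Jb Jb_apply gradY_apply_eq_sum_cdsB_Jb)
open B6KLevelCensusIndexV1 (KIdx)
open Node00.OpsYNablaBridge (chartY shiftY_chartY shiftY_symm_chartY bondCompY bondCompY_apply gradY_apply_eq_cdS divY_apply_eq_sum_cdsS cdS_apply cdsS_apply)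
open B9Eq39Adjoint (R R_one R_add R_sub R_smul R_zero R_neg R_inv_R R_R_inv R_mul plaqU)
open scoped Matrix

variable {𝔸 : Type} [NormedRing 𝔸] [NormedAlgebra ℂ 𝔸] [CompleteSpace 𝔸]
variable {d ℓ : ℕ} {hd : 1 ≤ d + 1} {hL : Odd (ℓ + 1) ∧ 1 < ℓ + 1} {b₀ b₁ : ℝ}
variable (i : KIdx d ℓ hd hL b₀ b₁)

/-! ## §1 The three building blocks: backward differences of the cut-off, forward ∕ backward transport-shifts -/

/-- the BACKWARD DIFFERENCE of a site profile per lattice step, `(∂⁻_μh)(z) = h(z) − h(z − e_μ)` (print's `∂h`, [4] p. 247 «|∂h_□| ≤ O(1)(MLʲη)⁻¹» per step).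
[cite: Balaban1985BackgroundPropagators, (3.100) p.413 («(∂_μh)(x)»), (3.88) p.409] -/
def dg (h : SiteY i → ℝ) (μ : Fin (d + 1)) : SiteY i → ℝ := fun z => h z - h ((shiftY i μ).symm z)

/-- the FORWARD TRANSPORT-SHIFT of a site function, `(T_νΦ)(z) = R(U_ν(z))Φ(z + e_ν)` (the value at the far end of the bond carried back along it, (3.3)).
[cite: Balaban1985BackgroundPropagators, (3.3) p.390, (3.100) p.413 («R(U(x, x+ηe_μ))A_ν(x+ηe_μ)»)] -/
def fwdT (U : CfgY 𝔸 i) (ν : Fin (d + 1)) (Φ : SiteY i → 𝔸) : SiteY i → 𝔸 := fun z => R (UboxY i U ν z) (Φ (shiftY i ν z))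

/-- the BACKWARD TRANSPORT-SHIFT, `(T*_μΦ)(z) = R(U_μ(z − e_μ))⁻¹Φ(z − e_μ)` ((3.8) with (3.5) `U(x, x−e_μ) = U(x−e_μ, x)⁻¹`).
[cite: Balaban1985BackgroundPropagators, (3.8) p.392, (3.5) p.391] -/
def bwdT (U : CfgY 𝔸 i) (μ : Fin (d + 1)) (Φ : SiteY i → 𝔸) : SiteY i → 𝔸 :=
  fun z => R (UboxY i U μ ((shiftY i μ).symm z))⁻¹ (Φ ((shiftY i μ).symm z))

omit [NormedRing 𝔸] [NormedAlgebra ℂ 𝔸] [CompleteSpace 𝔸] in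
/-- `dg`, evaluated. [cite: Balaban1985BackgroundPropagators, (3.100) p.413, bookkeeping] -/
theorem dg_apply (h : SiteY i → ℝ) (μ : Fin (d + 1)) (z : SiteY i) : dg i h μ z = h z - h ((shiftY i μ).symm z) := rfl

omit [NormedRing 𝔸] [NormedAlgebra ℂ 𝔸] [CompleteSpace 𝔸] in
/-- `dg` one step ahead is the forward difference: `(∂⁻_μh)(z + e_μ) = h(z + e_μ) − h(z)`. [cite: Balaban1985BackgroundPropagators, (3.100) p.413, bookkeeping] -/
theorem dg_shiftY (h : SiteY i → ℝ) (μ : Fin (d + 1)) (z : SiteY i) : dg i h μ (shiftY i μ z) = h (shiftY i μ z) - h z := by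
  rw [dg_apply, shiftY_symm_shiftY]

/-- `fwdT`, evaluated. [cite: Balaban1985BackgroundPropagators, (3.3) p.390, bookkeeping] -/
theorem fwdT_apply (U : CfgY 𝔸 i) (ν : Fin (d + 1)) (Φ : SiteY i → 𝔸) (z : SiteY i) :
    fwdT i U ν Φ z = R (UboxY i U ν z) (Φ (shiftY i ν z)) := rfl

/-- `bwdT`, evaluated. [cite: Balaban1985BackgroundPropagators, (3.8) p.392, bookkeeping] -/
theorem bwdT_apply (U : CfgY 𝔸 i) (μ : Fin (d + 1)) (Φ : SiteY i → 𝔸) (z : SiteY i) :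
    bwdT i U μ Φ z = R (UboxY i U μ ((shiftY i μ).symm z))⁻¹ (Φ ((shiftY i μ).symm z)) := rfl

/-! ## §2 Pointwise calculus: the Leibniz rule of `∇` solved for the cut-off, the far derivative carried round the corner -/

section Calculus

variable (U : CfgY 𝔸 i)

/-- `∇*_{U,μ}` of a pointwise difference is the difference. [cite: Balaban1985BackgroundPropagators, (3.8) p.392, bookkeeping] -/
theorem cdsS_sub_apply (μ : Fin (d + 1)) (F G : SiteY i → 𝔸) (z : SiteY i) :
    cdsS i U μ (fun w => F w - G w) z = cdsS i U μ F z - cdsS i U μ G z := by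
  simp only [cdsS_apply, R_sub]; abel

/-- `∇*_{U,μ}` is ℂ-homogeneous, pointwise. [cite: Balaban1985BackgroundPropagators, (3.8) p.392, bookkeeping] -/
theorem cdsS_smul_apply (μ : Fin (d + 1)) (c : ℂ) (F : SiteY i → 𝔸) (z : SiteY i) :
    cdsS i U μ (fun w => c • F w) z = c • cdsS i U μ F z := by
  simp only [cdsS_apply, R_smul, smul_sub]

/-- `∇_{U,μ}` is ℂ-homogeneous, pointwise. [cite: Balaban1985BackgroundPropagators, (3.3) p.390, bookkeeping] -/
theorem cdS_smul_apply (μ : Fin (d + 1)) (c : ℂ) (F : SiteY i → 𝔸) (z : SiteY i) :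
    cdS i U μ (fun w => c • F w) z = c • cdS i U μ F z := by
  simp only [cdS_apply, R_smul, smul_sub]

/-- **(3.100) SOLVED FOR THE CUT-OFF IN FRONT OF `∇`**: for a real `g`, `g(x)•(∇_{U,ν}Θ)(x) = ∇_{U,ν}(gΘ)(x) − (g(x+e_ν) − g(x))•(T_νΘ)(x)`.
[cite: Balaban1985BackgroundPropagators, (3.100) p.413, (3.3) p.390] -/
theorem smul_cdS_eq (ν : Fin (d + 1)) (g : SiteY i → ℝ) (Θ : SiteY i → 𝔸) (x : SiteY i) :
    ((g x : ℝ) : ℂ) • cdS i U ν Θ x = cdS i U ν (cutMulY g Θ) x - ((g (shiftY i ν x) - g x : ℝ) : ℂ) • fwdT i U ν Θ x := by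
  have e : cdS i U ν Θ x = R (UboxY i U ν x) (Θ (shiftY i ν x)) - Θ x := rfl
  rw [cdS_cutMulY_apply, fwdT_apply, e, Complex.ofReal_sub, sub_smul, smul_sub]
  abel

/-- **THE NEAR DERIVATIVE CARRIED BACK ALONG ITS OWN BOND — (3.5)**: `R(U_μ(x−e_μ))⁻¹(∇_{U,μ}Ψ)(x−e_μ) = −(∇*_{U,μ}Ψ)(x)`.
[cite: Balaban1985BackgroundPropagators, (3.8) p.392, (3.5) p.391, p.398 («we may always replace ∇_U by ∇*_U»)] -/
theorem R_inv_cdS_symm_eq (μ : Fin (d + 1)) (Ψ : SiteY i → 𝔸) (x : SiteY i) :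
    R (UboxY i U μ ((shiftY i μ).symm x))⁻¹ (cdS i U μ Ψ ((shiftY i μ).symm x)) = -cdsS i U μ Ψ x := by
  rw [OpsYRead342Cross.cdsS_apply_eq_neg_R_cdS i U μ Ψ x, neg_neg]

/-- **THE FAR TRANSVERSE DERIVATIVE CARRIED ROUND THE CORNER — (3.7)**: with `w = x − e_μ`, `Y = R(U_ν(w))Φ(w+e_ν)` and the plaquette variable
`U(∂p) = U_μ(w)U_ν(x)U_μ(w+e_ν)⁻¹U_ν(w)⁻¹` of `p = p_{μν}(w)`,
`R(U_μ(w))⁻¹(∇_{U,ν}Φ)(w) = ∇_{U,ν}(T*_μΦ)(x) + R(U_μ(w))⁻¹(Y − R(U(∂p))Y)` — the derivative of the transported function at `x` plus a holonomy defect.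
[cite: Balaban1985BackgroundPropagators, (3.7) p.391, (3.3) p.390, (3.5) p.391] -/
theorem R_inv_cdS_cross_eq (μ ν : Fin (d + 1)) (Φ : SiteY i → 𝔸) (x : SiteY i) :
    R (UboxY i U μ ((shiftY i μ).symm x))⁻¹ (cdS i U ν Φ ((shiftY i μ).symm x))
      = cdS i U ν (bwdT i U μ Φ) x
        + R (UboxY i U μ ((shiftY i μ).symm x))⁻¹
            (R (UboxY i U ν ((shiftY i μ).symm x)) (Φ (shiftY i ν ((shiftY i μ).symm x)))
              - R (plaqU (shiftY i) (UboxY i U) μ ν ((shiftY i μ).symm x))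
                  (R (UboxY i U ν ((shiftY i μ).symm x)) (Φ (shiftY i ν ((shiftY i μ).symm x))))) := by
  have hc : (shiftY i μ).symm (shiftY i ν x) = shiftY i ν ((shiftY i μ).symm x) := shiftY_symm_shiftY_comm i μ ν x
  have hs : shiftY i μ ((shiftY i μ).symm x) = x := shiftY_shiftY_symm i μ x
  have corner : ∀ Z : 𝔸, R (UboxY i U ν x) (R (UboxY i U μ (shiftY i ν ((shiftY i μ).symm x)))⁻¹ Z)
      = R (UboxY i U μ ((shiftY i μ).symm x))⁻¹
          (R (plaqU (shiftY i) (UboxY i U) μ ν ((shiftY i μ).symm x)) (R (UboxY i U ν ((shiftY i μ).symm x)) Z)) := by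
    intro Z
    unfold plaqU
    rw [hs]
    exact (transport_corner _ _ _ _ Z).symm
  have e1 : cdS i U ν Φ ((shiftY i μ).symm x)
      = R (UboxY i U ν ((shiftY i μ).symm x)) (Φ (shiftY i ν ((shiftY i μ).symm x))) - Φ ((shiftY i μ).symm x) := rfl
  have e2 : cdS i U ν (bwdT i U μ Φ) x = R (UboxY i U ν x) (bwdT i U μ Φ (shiftY i ν x)) - bwdT i U μ Φ x := rfl
  rw [e1, e2, bwdT_apply, bwdT_apply, hc, corner, R_sub, R_sub]
  abel

/-- **THE FAR ADJOINT DERIVATIVE CARRIED BACK — (3.7) again**: with `w = x − e_μ`, `Y`, `U(∂p)` as above,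
`R(U_ν(x))(∇*_{U,μ}Φ)(x+e_ν) = ∇*_{U,μ}(T_νΦ)(x) + R(U_μ(w))⁻¹(R(U(∂p))Y − Y)`.
[cite: Balaban1985BackgroundPropagators, (3.7) p.391, (3.8) p.392, (3.5) p.391] -/
theorem R_cdsS_shift_eq (μ ν : Fin (d + 1)) (Φ : SiteY i → 𝔸) (x : SiteY i) :
    R (UboxY i U ν x) (cdsS i U μ Φ (shiftY i ν x))
      = cdsS i U μ (fwdT i U ν Φ) x
        + R (UboxY i U μ ((shiftY i μ).symm x))⁻¹
            (R (plaqU (shiftY i) (UboxY i U) μ ν ((shiftY i μ).symm x))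
                (R (UboxY i U ν ((shiftY i μ).symm x)) (Φ (shiftY i ν ((shiftY i μ).symm x))))
              - R (UboxY i U ν ((shiftY i μ).symm x)) (Φ (shiftY i ν ((shiftY i μ).symm x)))) := by
  have hc : (shiftY i μ).symm (shiftY i ν x) = shiftY i ν ((shiftY i μ).symm x) := shiftY_symm_shiftY_comm i μ ν x
  have hs : shiftY i μ ((shiftY i μ).symm x) = x := shiftY_shiftY_symm i μ x
  have corner : ∀ Z : 𝔸, R (UboxY i U ν x) (R (UboxY i U μ (shiftY i ν ((shiftY i μ).symm x)))⁻¹ Z)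
      = R (UboxY i U μ ((shiftY i μ).symm x))⁻¹
          (R (plaqU (shiftY i) (UboxY i U) μ ν ((shiftY i μ).symm x)) (R (UboxY i U ν ((shiftY i μ).symm x)) Z)) := by
    intro Z
    unfold plaqU
    rw [hs]
    exact (transport_corner _ _ _ _ Z).symm
  have e1 : cdsS i U μ Φ (shiftY i ν x)
      = R (UboxY i U μ ((shiftY i μ).symm (shiftY i ν x)))⁻¹ (Φ ((shiftY i μ).symm (shiftY i ν x))) - Φ (shiftY i ν x) := rfl
  have e2 : cdsS i U μ (fwdT i U ν Φ) x
      = R (UboxY i U μ ((shiftY i μ).symm x))⁻¹ (fwdT i U ν Φ ((shiftY i μ).symm x)) - fwdT i U ν Φ x := rfl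
  rw [e1, e2, fwdT_apply, fwdT_apply, hc, R_sub, corner, R_sub]
  abel

end Calculus

/-! ## §3 The plaquette letters through components: the curl of a cut-off commutator, the Jordan insertion as `jIns` -/

section Plaquettes

variable (U : CfgY 𝔸 i)

omit [CompleteSpace 𝔸] in
/-- a cut-off read on plaquettes multiplies the components: `(h_P·W)_{ae}(z) = h(z)•W_{ae}(z)`. [cite: Balaban1985BackgroundPropagators, (3.4) p.391, bookkeeping] -/
theorem extP_cutMulY_hPlY (h : SiteY i → ℝ) (W : PlaqY i → 𝔸) (a e : Fin (d + 1)) (z : SiteY i) :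
    extP i (cutMulY (hPlY i h) W) a e z = ((h z : ℝ) : ℂ) • extP i W a e z := by
  unfold extP
  split_ifs with hae
  · rw [cutMulY_apply, hPlY_apply]
    have e : chartY i ((⟨(chartY i).symm z, a, e, hae⟩ : PlaqY i).src) = z := Equiv.apply_symm_apply _ _
    rw [e]
  · rw [smul_zero]

omit [NormedAlgebra ℂ 𝔸] [CompleteSpace 𝔸] in
/-- components of a difference. [cite: Balaban1985BackgroundPropagators, (3.4) p.391, bookkeeping] -/
theorem extP_sub (F G : PlaqY i → 𝔸) (a e : Fin (d + 1)) (z : SiteY i) :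
    extP i (fun p => F p - G p) a e z = extP i F a e z - extP i G a e z := by
  unfold extP
  split_ifs
  · rfl
  · rw [sub_zero]

/-- **THE CURL'S COMPONENTS THROUGH THE SITE DERIVATIVES OF THE COMPONENTS — (3.4)**: `(D_UΛ)_{ae}(z) = [a < e]·c_f•((∇_aΛ_e)(z) − (∇_eΛ_a)(z))`.
[cite: Balaban1985BackgroundPropagators, (3.4) p.391, (3.3) p.390] -/
theorem extP_curlY' (Λ : FBondY i → 𝔸) (a e : Fin (d + 1)) (z : SiteY i) :
    extP i (curlY i U Λ) a e z
      = if a < e then ((i.cf : ℝ) : ℂ) • (cdS i U a (bondCompY i e Λ) z - cdS i U e (bondCompY i a Λ) z) else 0 := by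
  have hz : z = chartY i ((chartY i).symm z) := (Equiv.apply_symm_apply _ _).symm
  conv_lhs => rw [hz, extP_curlY, cdB_eq_cdS_bondCompY, cdB_eq_cdS_bondCompY]
  rw [← hz, smul_sub]

/-- **THE JORDAN-INSERTED CURL'S COMPONENTS**: `(𝒦_U D_UΛ)_{μν}(z) = jIns_{μν,z}((∇_μΛ_ν)(z) − (∇_νΛ_μ)(z))` (`jIns` carries the curl's `c_f` and vanishes unless
`μ < ν`). [cite: Balaban1985BackgroundPropagators, (3.10) p.392, (3.4) p.391] -/
theorem extP_jordan_curlY (Λ : FBondY i → 𝔸) (μ ν : Fin (d + 1)) (z : SiteY i) :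
    extP i (jordanY i U (curlY i U Λ)) μ ν z = jIns i U μ ν z (cdS i U μ (bondCompY i ν Λ) z - cdS i U ν (bondCompY i μ Λ) z) := by
  rw [extP_jordanY, extP_curlY']
  unfold jIns
  split_ifs with hμν
  · simp only [LinearMap.smul_apply, LinearMap.add_apply, LinearMap.mulRight_apply, LinearMap.mulLeft_apply, smul_mul_assoc, mul_smul_comm, smul_add]
    module
  · rw [LinearMap.zero_apply, LinearMap.zero_apply]

/-- **THE COMPONENTS OF `[h]D_U Λ` (the curl of a cut-off commutator)**, `c_f`-free: `N_{ae}(z) = −(∂⁻_ah)(z+e_a)•(T_aΛ_e)(z) + (∂⁻_eh)(z+e_e)•(T_eΛ_a)(z)`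
(print's `(∂_μh)(x)R(U(x,x+ηe_μ))A_ν(x+ηe_μ)` per edge of the plaquette). [cite: Balaban1985BackgroundPropagators, (3.100) p.413, (3.4) p.391] -/
def curlCommComp (h : SiteY i → ℝ) (U : CfgY 𝔸 i) (Λ : FBondY i → 𝔸) (a e : Fin (d + 1)) : SiteY i → 𝔸 := fun z =>
  -(((dg i h a (shiftY i a z) : ℝ) : ℂ) • fwdT i U a (bondCompY i e Λ) z) + ((dg i h e (shiftY i e z) : ℝ) : ℂ) • fwdT i U e (bondCompY i a Λ) z

/-- `curlCommComp` is antisymmetric in the direction pair. [cite: Balaban1985BackgroundPropagators, (3.5) p.391 (orientation), bookkeeping] -/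
theorem curlCommComp_swap (h : SiteY i → ℝ) (Λ : FBondY i → 𝔸) (a e : Fin (d + 1)) (z : SiteY i) :
    curlCommComp i h U Λ e a z = -curlCommComp i h U Λ a e z := by
  unfold curlCommComp; abel

/-- ★ **THE JORDAN-INSERTED COMPONENTS OF `([h]D_U)Λ`**: `(𝒦_U([h_P | h_B]D_U)Λ)_{μν}(z) = jIns_{μν,z}(N_{μν}(z))` — the cut-off commutator of the curl kills
the derivative: `h(z)(∇_aΛ_e)(z) − ∇_a(hΛ_e)(z) = −(h(z+e_a) − h(z))•R(U_a(z))Λ_e(z+e_a)`. [cite: Balaban1985BackgroundPropagators, (3.100) p.413, (3.4) p.391, (3.10) p.392] -/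
theorem extP_jordan_curlComm (h : SiteY i → ℝ) (Λ : FBondY i → 𝔸) (μ ν : Fin (d + 1)) (z : SiteY i) :
    extP i (jordanY i U (cutCommR (hPlY i h) (hBdY i h) (curlY i U) Λ)) μ ν z = jIns i U μ ν z (curlCommComp i h U Λ μ ν z) := by
  have hfun : cutCommR (hPlY i h) (hBdY i h) (curlY i U) Λ = fun p => cutMulY (hPlY i h) (curlY i U Λ) p - curlY i U (cutMulY (hBdY i h) Λ) p := by
    funext p; rw [cutCommR_apply, cutMulY_apply]
  rw [extP_jordanY, hfun, extP_sub, extP_cutMulY_hPlY, extP_curlY', extP_curlY', bondCompY_cutMulY, bondCompY_cutMulY]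
  unfold jIns curlCommComp
  split_ifs with hμν
  · -- the commutator of the curl, component-wise
    have key : ((h z : ℝ) : ℂ) • (((i.cf : ℝ) : ℂ) • (cdS i U μ (bondCompY i ν Λ) z - cdS i U ν (bondCompY i μ Λ) z))
          - ((i.cf : ℝ) : ℂ) • (cdS i U μ (cutMulY h (bondCompY i ν Λ)) z - cdS i U ν (cutMulY h (bondCompY i μ Λ)) z)
        = ((i.cf : ℝ) : ℂ) • (-(((dg i h μ (shiftY i μ z) : ℝ) : ℂ) • fwdT i U μ (bondCompY i ν Λ) z)
            + ((dg i h ν (shiftY i ν z) : ℝ) : ℂ) • fwdT i U ν (bondCompY i μ Λ) z) := by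
      have e1 : cdS i U μ (bondCompY i ν Λ) z = R (UboxY i U μ z) (bondCompY i ν Λ (shiftY i μ z)) - bondCompY i ν Λ z := rfl
      have e2 : cdS i U ν (bondCompY i μ Λ) z = R (UboxY i U ν z) (bondCompY i μ Λ (shiftY i ν z)) - bondCompY i μ Λ z := rfl
      rw [cdS_cutMulY_apply, cdS_cutMulY_apply, e1, e2, dg_shiftY, dg_shiftY, fwdT_apply, fwdT_apply, smul_comm (((h z : ℝ)) : ℂ),
        ← smul_sub, Complex.ofReal_sub, Complex.ofReal_sub]
      congr 1
      simp only [smul_sub, sub_smul, neg_sub]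
      abel
    rw [key]
    simp only [LinearMap.smul_apply, LinearMap.add_apply, LinearMap.mulRight_apply, LinearMap.mulLeft_apply, add_mul, mul_add, neg_mul, mul_neg,
      smul_mul_assoc, mul_smul_comm, smul_add, smul_neg]
    module
  · simp only [smul_zero, sub_zero, LinearMap.zero_apply]

end Plaquettes

/-! ## §4 The four first-order pieces of `K(h)Λ` regrouped for a left factor -/

section Pieces

variable (h : SiteY i → ℝ) (U : CfgY 𝔸 i) (Λ : FBondY i → 𝔸)

/-- **INPUT OF `D*𝒦([h]D)Λ = Σ_μ∇*_μ(dCurl_μ)`**: `dCurl_μ(⟨y,ν⟩) = (jIns_{μν} + jIns_{νμ})_{chart y}(N_{μν}(chart y))` — zeroth order in `Λ`, one `∂h` small.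
[cite: Balaban1985BackgroundPropagators, (3.9)–(3.10) p.392, (3.100) p.413] -/
def dCurl (μ : Fin (d + 1)) : FBondY i → 𝔸 := fun b =>
  (jIns i U μ b.dir (chartY i b.src) + jIns i U b.dir μ (chartY i b.src)) (curlCommComp i h U Λ μ b.dir (chartY i b.src))

/-- ★ **PIECE `D*_U ∘ 𝒦_U ∘ ([h]D_U)` IS A SUM OF ADJOINT DERIVATIVES, EXACTLY**: `(D*𝒦([h]D)Λ)(b) = Σ_μ (∇*_{U,μ} dCurl_μ)(b)` ((3.9) through components).
[cite: Balaban1985BackgroundPropagators, (3.9) p.392, (3.10) p.392, (3.100) p.413] -/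
theorem coCurl_jordan_curlComm_apply (b : FBondY i) :
    (coCurlY i U ∘ₗ jordanY i U ∘ₗ cutCommR (hPlY i h) (hBdY i h) (curlY i U)) Λ b = ∑ μ : Fin (d + 1), cdsB i U μ (dCurl i h U Λ μ) b := by
  rw [LinearMap.comp_apply, LinearMap.comp_apply, coCurlY_apply_eq, Finset.smul_sum]
  refine Finset.sum_congr rfl fun μ _ => ?_
  have hcomp : bondCompY i b.dir (dCurl i h U Λ μ)
      = fun z => extP i (jordanY i U (cutCommR (hPlY i h) (hBdY i h) (curlY i U) Λ)) μ b.dir z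
          - extP i (jordanY i U (cutCommR (hPlY i h) (hBdY i h) (curlY i U) Λ)) b.dir μ z := by
    funext z
    rw [bondCompY_apply, extP_jordan_curlComm, extP_jordan_curlComm, curlCommComp_swap (a := μ) (e := b.dir), map_neg, sub_neg_eq_add]
    show (jIns i U μ b.dir (chartY i ((chartY i).symm z)) + jIns i U b.dir μ (chartY i ((chartY i).symm z)))
        (curlCommComp i h U Λ μ b.dir (chartY i ((chartY i).symm z))) = _
    rw [Equiv.apply_symm_apply, LinearMap.add_apply]
  rw [cdsB_eq_cdsS_bondCompY, hcomp, cdsS_sub_apply]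

/-- **INPUT OF `D([h]D*)Λ = Σ_μ∇*_μ(J_μ dDiv)`**: the site function `dDiv = ([h | h_B]D*_U)Λ = c_f•Σ_a (∂⁻_ah)•T*_aΛ_a` — zeroth order, one `∂h` small.
[cite: Balaban1985BackgroundPropagators, (3.8) p.392, (3.100) p.413 («similarly for adjoint derivatives»)] -/
def dDiv : SiteY i → 𝔸 := fun z => ((i.cf : ℝ) : ℂ) • ∑ a : Fin (d + 1), ((dg i h a z : ℝ) : ℂ) • bwdT i U a (bondCompY i a Λ) z

/-- the cut-off commutator of the divergence IS `dDiv`: `h(z)(D*Λ)(z) − (D*(hΛ))(z) = c_f Σ_a (h(z) − h(z−e_a))•R(U_a(z−e_a))⁻¹Λ_a(z−e_a)`.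
[cite: Balaban1985BackgroundPropagators, (3.100) p.413, (3.8) p.392] -/
theorem divComm_apply (z : SiteY i) : cutCommR h (hBdY i h) (divY i U) Λ z = dDiv i h U Λ z := by
  rw [cutCommR_apply, divY_apply_eq_sum_cdsS, divY_apply_eq_sum_cdsS, smul_comm (((h z : ℝ)) : ℂ), ← smul_sub, Finset.smul_sum,
    ← Finset.sum_sub_distrib]
  unfold dDiv
  congr 1
  refine Finset.sum_congr rfl fun a _ => ?_
  rw [bondCompY_cutMulY, ← cutMulY_apply (𝔸 := 𝔸) h (cdsS i U a (bondCompY i a Λ)) z, cutMulY_cdsS_eq, add_sub_cancel_left, dg_apply, bwdT_apply]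

/-- ★ **PIECE `D_U ∘ ([h]D*_U)` IS A SUM OF ADJOINT DERIVATIVES, EXACTLY**: `(D([h]D*)Λ)(b) = Σ_μ (∇*_{U,μ} J_μ dDiv)(b)` (`D_U = Σ_μ∇*_{U,μ}∘J_μ`).
[cite: Balaban1985BackgroundPropagators, (3.3) p.390, (3.8) p.392, p.398 («we may always replace ∇_U by ∇*_U»)] -/
theorem grad_divComm_apply (b : FBondY i) :
    (gradY i U ∘ₗ cutCommR h (hBdY i h) (divY i U)) Λ b = ∑ μ : Fin (d + 1), cdsB i U μ (Jb i U μ (dDiv i h U Λ)) b := by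
  have hfun : cutCommR h (hBdY i h) (divY i U) Λ = dDiv i h U Λ := funext fun z => divComm_apply i h U Λ z
  rw [LinearMap.comp_apply, hfun, gradY_apply_eq_sum_cdsB_Jb]

/-- **THE CUT-OFF COMMUTATOR OF THE CO-CURL ON ANY PLAQUETTE FUNCTION**: `(([h_B | h_P]D*_U)W)(⟨y,ν⟩) = c_f Σ_μ (∂⁻_μh)(x)•R(U_μ(x−e_μ))⁻¹(W_{μν} − W_{νμ})(x−e_μ)`,
`x = chart y` — only the plaquettes BEHIND the bond contribute (the ones through `y` carry `h(y) − h(y) = 0`).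
[cite: Balaban1985BackgroundPropagators, (3.9) p.392, (3.100) p.413] -/
theorem coCurlComm_apply (W : PlaqY i → 𝔸) (b : FBondY i) :
    cutCommR (hBdY i h) (hPlY i h) (coCurlY i U) W b
      = ((i.cf : ℝ) : ℂ) • ∑ μ : Fin (d + 1), ((dg i h μ (chartY i b.src) : ℝ) : ℂ) •
          R (UboxY i U μ ((shiftY i μ).symm (chartY i b.src)))⁻¹
            (extP i W μ b.dir ((shiftY i μ).symm (chartY i b.src)) - extP i W b.dir μ ((shiftY i μ).symm (chartY i b.src))) := by
  have hP : ∀ a e, extP i (cutMulY (hPlY i h) W) a e = cutMulY h (extP i W a e) := fun a e =>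
    funext fun z => by rw [extP_cutMulY_hPlY, cutMulY_apply]
  rw [cutCommR_apply, coCurlY_apply_eq, coCurlY_apply_eq, hBdY_apply, smul_comm (((h (chartY i b.src) : ℝ)) : ℂ), ← smul_sub, Finset.smul_sum,
    ← Finset.sum_sub_distrib]
  congr 1
  refine Finset.sum_congr rfl fun μ _ => ?_
  set x := chartY i b.src with hx
  rw [hP, hP, smul_sub]
  have e1 := cutMulY_cdsS_eq i U μ h (extP i W μ b.dir) x
  have e2 := cutMulY_cdsS_eq i U μ h (extP i W b.dir μ) x
  rw [cutMulY_apply] at e1 e2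
  rw [e1, e2, dg_apply, R_sub, smul_sub]
  abel

/-- **INPUT OF THE `∇*_μ`-PART OF `([h]D*)(𝒦DΛ)`**: `dMul_μ = −c_f•(∂⁻_μh)·Λ` (the cut-off's backward difference read on bonds).
[cite: Balaban1985BackgroundPropagators, (3.100) p.413, (3.5) p.391] -/
def dMul (μ : Fin (d + 1)) : FBondY i → 𝔸 := fun b => -(((i.cf : ℝ) : ℂ) • cutMulY (hBdY i (dg i h μ)) Λ b)

/-- **INPUT OF THE `D_U`-PART OF `([h]D*)(𝒦DΛ)`**: the site function `dBwd_μ = −c_f•(∂⁻_μh)•T*_μΛ_μ` (read through `D_U = Σ_λ∇*_λ∘J_λ`).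
[cite: Balaban1985BackgroundPropagators, (3.8) p.392, (3.7) p.391, (3.100) p.413] -/
def dBwd (μ : Fin (d + 1)) : SiteY i → 𝔸 := fun z => -(((i.cf : ℝ) : ℂ) • (((dg i h μ z : ℝ) : ℂ) • bwdT i U μ (bondCompY i μ Λ) z))

/-- **REMAINDER `zSec`**: the second difference of `h` along `μ` against the value behind the bond,
`zSec_μ(⟨y,ν⟩) = −c_f²((∂⁻_μh)(x) − (∂⁻_μh)(x−e_μ))•R(U_μ(x−e_μ))⁻¹Λ_ν(x−e_μ)` («O(M⁻²), if considered on a proper scale»).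
[cite: Balaban1985BackgroundPropagators, p.414 l.1–2; Balaban1984PropagatorsII, p.247 («|Δh_□| ≤ O(1)(MLʲη)⁻²»)] -/
def zSec (μ : Fin (d + 1)) : FBondY i → 𝔸 := fun b =>
  -(((i.cf ^ 2 : ℝ) : ℂ) • ((dg i h μ (chartY i b.src) - dg i h μ ((shiftY i μ).symm (chartY i b.src)) : ℝ) : ℂ) •
      R (UboxY i U μ ((shiftY i μ).symm (chartY i b.src)))⁻¹ (bondCompY i b.dir Λ ((shiftY i μ).symm (chartY i b.src))))

/-- **REMAINDER `zMixB`**: the mixed second difference of `h` against the transported value `T_ν T*_μ Λ_μ`,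
`zMixB_μ(⟨y,ν⟩) = c_f²((∂⁻_μh)(x+e_ν) − (∂⁻_μh)(x))•(T_νT*_μΛ_μ)(x)`. [cite: Balaban1985BackgroundPropagators, p.414 l.1–2, (3.7) p.391] -/
def zMixB (μ : Fin (d + 1)) : FBondY i → 𝔸 := fun b =>
  ((i.cf ^ 2 : ℝ) : ℂ) • ((dg i h μ (shiftY i b.dir (chartY i b.src)) - dg i h μ (chartY i b.src) : ℝ) : ℂ) •
    fwdT i U b.dir (bwdT i U μ (bondCompY i μ Λ)) (chartY i b.src)

/-- **REMAINDER `zHolB`**: the plaquette-holonomy defect behind the bond, `zHolB_μ(⟨y,ν⟩) = −c_f²(∂⁻_μh)(x)•R(U_μ(w))⁻¹(Y − R(U(∂p_{μν}(w)))Y)`,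
`w = x − e_μ`, `Y = R(U_ν(w))Λ_μ(w+e_ν)`. [cite: Balaban1985BackgroundPropagators, (3.7) p.391, (3.35) p.396, (3.69) p.404] -/
def zHolB (μ : Fin (d + 1)) : FBondY i → 𝔸 := fun b =>
  -(((i.cf ^ 2 : ℝ) : ℂ) • ((dg i h μ (chartY i b.src) : ℝ) : ℂ) •
      R (UboxY i U μ ((shiftY i μ).symm (chartY i b.src)))⁻¹
        (R (UboxY i U b.dir ((shiftY i μ).symm (chartY i b.src))) (bondCompY i μ Λ (shiftY i b.dir ((shiftY i μ).symm (chartY i b.src))))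
          - R (plaqU (shiftY i) (UboxY i U) μ b.dir ((shiftY i μ).symm (chartY i b.src)))
              (R (UboxY i U b.dir ((shiftY i μ).symm (chartY i b.src))) (bondCompY i μ Λ (shiftY i b.dir ((shiftY i μ).symm (chartY i b.src)))))))

/-- **REMAINDER `zJor`**: the defect of the Jordan insertion from the identity, acting on the curl behind the bond,
`zJor_μ(⟨y,ν⟩) = c_f(∂⁻_μh)(x)•R(U_μ(w))⁻¹((jIns_{μν,w} + jIns_{νμ,w}) − c_f)(∇_μΛ_ν − ∇_νΛ_μ)(w)` («The operator Δ′ is small and local by (3.10)»: `𝒦 − 1`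
carries `Re U(∂p) − 1`). [cite: Balaban1985BackgroundPropagators, (3.10) p.392, p.414 l.2–3, (3.69) p.404] -/
def zJor (μ : Fin (d + 1)) : FBondY i → 𝔸 := fun b =>
  ((i.cf : ℝ) : ℂ) • ((dg i h μ (chartY i b.src) : ℝ) : ℂ) •
    R (UboxY i U μ ((shiftY i μ).symm (chartY i b.src)))⁻¹
      ((jIns i U μ b.dir ((shiftY i μ).symm (chartY i b.src)) + jIns i U b.dir μ ((shiftY i μ).symm (chartY i b.src)))
          (cdS i U μ (bondCompY i b.dir Λ) ((shiftY i μ).symm (chartY i b.src)) - cdS i U b.dir (bondCompY i μ Λ) ((shiftY i μ).symm (chartY i b.src)))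
        - ((i.cf : ℝ) : ℂ) • (cdS i U μ (bondCompY i b.dir Λ) ((shiftY i μ).symm (chartY i b.src))
            - cdS i U b.dir (bondCompY i μ Λ) ((shiftY i μ).symm (chartY i b.src))))

/-- ★★ **PIECE `([h]D*_U)(𝒦_UD_UΛ)` REGROUPED FOR A LEFT FACTOR**: at `b = ⟨y,ν⟩`,
`(([h]D*)𝒦DΛ)(b) = Σ_μ (∇*_{U,μ} dMul_μ)(b) + Σ_μΣ_λ (∇*_{U,λ} J_λ dBwd_μ)(b) + Σ_μ (zSec_μ + zMixB_μ + zHolB_μ + zJor_μ)(b)` — the only piece of `K(h)` with a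
derivative of `Λ` behind a coefficient; the near derivative `∇_μΛ_ν(x−e_μ)` becomes `−R(U_μ)∇*_μΛ_ν(x)`, the far one `∇_νΛ_μ(x−e_μ)` becomes `∇_ν(T*_μΛ_μ)(x)` round
the corner, the cut-off differences are moved inside the derivatives ((3.100) solved for `h`), and `𝒦 = c_f + (𝒦 − c_f)`.
[cite: Balaban1985BackgroundPropagators, (3.9)–(3.10) p.392, (3.7) p.391, (3.100) p.413, p.414 l.1–3, p.398] -/
theorem coCurlComm_jordan_curl_apply (b : FBondY i) :
    (cutCommR (hBdY i h) (hPlY i h) (coCurlY i U) ∘ₗ jordanY i U ∘ₗ curlY i U) Λ b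
      = (∑ μ : Fin (d + 1), cdsB i U μ (dMul i h Λ μ) b)
        + (∑ μ : Fin (d + 1), ∑ lam : Fin (d + 1), cdsB i U lam (Jb i U lam (dBwd i h U Λ μ)) b)
        + ∑ μ : Fin (d + 1), (zSec i h U Λ μ b + zMixB i h U Λ μ b + zHolB i h U Λ μ b + zJor i h U Λ μ b) := by
  rw [LinearMap.comp_apply, LinearMap.comp_apply, coCurlComm_apply, Finset.smul_sum, ← Finset.sum_add_distrib, ← Finset.sum_add_distrib]
  refine Finset.sum_congr rfl fun μ _ => ?_
  -- names: the site `x`, the direction `ν`, the site `w = x − e_μ` behind, its bond variable `V`, the curl component `D` at `w`, the corner value `Y`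
  obtain ⟨x, hx⟩ : ∃ x : SiteY i, x = chartY i b.src := ⟨_, rfl⟩
  obtain ⟨ν, hν⟩ : ∃ ν : Fin (d + 1), ν = b.dir := ⟨_, rfl⟩
  obtain ⟨w, hw⟩ : ∃ w : SiteY i, w = (shiftY i μ).symm x := ⟨_, rfl⟩
  obtain ⟨V, hV⟩ : ∃ V : 𝔸ˣ, V = UboxY i U μ w := ⟨_, rfl⟩
  obtain ⟨D, hD⟩ : ∃ D : 𝔸, D = cdS i U μ (bondCompY i ν Λ) w - cdS i U ν (bondCompY i μ Λ) w := ⟨_, rfl⟩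
  obtain ⟨Y, hY⟩ : ∃ Y : 𝔸, Y = R (UboxY i U ν w) (bondCompY i μ Λ (shiftY i ν w)) := ⟨_, rfl⟩
  obtain ⟨P, hP⟩ : ∃ P : 𝔸ˣ, P = plaqU (shiftY i) (UboxY i U) μ ν w := ⟨_, rfl⟩
  -- the components of `𝒦DΛ` behind the bond: the symmetrised insertion on `D`, split as `c_f•D + (K − c_f)D`
  have hW : extP i (jordanY i U (curlY i U Λ)) μ ν w - extP i (jordanY i U (curlY i U Λ)) ν μ w
      = ((i.cf : ℝ) : ℂ) • D + ((jIns i U μ ν w + jIns i U ν μ w) D - ((i.cf : ℝ) : ℂ) • D) := by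
    rw [extP_jordan_curlY, extP_jordan_curlY, add_sub_cancel, LinearMap.add_apply, hD]
    rw [show cdS i U ν (bondCompY i μ Λ) w - cdS i U μ (bondCompY i ν Λ) w = -(cdS i U μ (bondCompY i ν Λ) w - cdS i U ν (bondCompY i μ Λ) w) by abel,
      map_neg, sub_neg_eq_add]
  -- the `c_f•D` part: both derivatives moved to `x`
  have hRD : R V⁻¹ D = -cdsS i U μ (bondCompY i ν Λ) x - cdS i U ν (bwdT i U μ (bondCompY i μ Λ)) x - R V⁻¹ (Y - R P Y) := by
    rw [hD, R_sub, hV, hY, hP, hw, R_inv_cdS_symm_eq, R_inv_cdS_cross_eq]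
    abel
  -- the cut-off differences moved inside the derivatives
  have hL1 := cutMulY_cdsS_eq i U μ (dg i h μ) (bondCompY i ν Λ) x
  rw [cutMulY_apply, ← hw, ← hV] at hL1
  have hA1 : cdsS i U μ (cutMulY (dg i h μ) (bondCompY i ν Λ)) x
      = ((dg i h μ x : ℝ) : ℂ) • cdsS i U μ (bondCompY i ν Λ) x - ((dg i h μ x - dg i h μ w : ℝ) : ℂ) • R V⁻¹ (bondCompY i ν Λ w) :=
    eq_sub_of_add_eq hL1.symm
  have hL2 := smul_cdS_eq i U ν (dg i h μ) (bwdT i U μ (bondCompY i μ Λ)) x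
  have hA2 : cdS i U ν (cutMulY (dg i h μ) (bwdT i U μ (bondCompY i μ Λ))) x
      = ((dg i h μ x : ℝ) : ℂ) • cdS i U ν (bwdT i U μ (bondCompY i μ Λ)) x
        + ((dg i h μ (shiftY i ν x) - dg i h μ x : ℝ) : ℂ) • fwdT i U ν (bwdT i U μ (bondCompY i μ Λ)) x :=
    sub_eq_iff_eq_add.mp hL2.symm
  -- the two derivative terms as bond-sector adjoint derivatives
  have hB1 : cdsB i U μ (dMul i h Λ μ) b = -(((i.cf : ℝ) : ℂ) • (((i.cf : ℝ) : ℂ) • cdsS i U μ (cutMulY (dg i h μ) (bondCompY i ν Λ)) x)) := by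
    have hc : bondCompY i ν (dMul i h Λ μ) = fun z => -((i.cf : ℝ) : ℂ) • cutMulY (dg i h μ) (bondCompY i ν Λ) z := by
      funext z
      rw [bondCompY_apply, show dMul i h Λ μ ⟨(chartY i).symm z, ν⟩ = -(((i.cf : ℝ) : ℂ) • cutMulY (hBdY i (dg i h μ)) Λ ⟨(chartY i).symm z, ν⟩) from rfl,
        ← bondCompY_apply i ν (cutMulY (hBdY i (dg i h μ)) Λ) z, bondCompY_cutMulY, neg_smul]
    rw [cdsB_eq_cdsS_bondCompY, ← hν, ← hx, hc, cdsS_smul_apply, neg_smul, smul_neg]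
  have hB2 : ∑ lam : Fin (d + 1), cdsB i U lam (Jb i U lam (dBwd i h U Λ μ)) b
      = -(((i.cf : ℝ) : ℂ) • (((i.cf : ℝ) : ℂ) • cdS i U ν (cutMulY (dg i h μ) (bwdT i U μ (bondCompY i μ Λ))) x)) := by
    have hc : dBwd i h U Λ μ = fun z => -((i.cf : ℝ) : ℂ) • cutMulY (dg i h μ) (bwdT i U μ (bondCompY i μ Λ)) z := by
      funext z; rw [cutMulY_apply, neg_smul]; rfl
    rw [← gradY_apply_eq_sum_cdsB_Jb, gradY_apply_eq_cdS, ← hν, ← hx, hc, cdS_smul_apply, neg_smul, smul_neg]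
  -- assemble: everything as a linear combination of seven atoms
  rw [hB1, hB2, hA1, hA2]
  simp only [zSec, zMixB, zHolB, zJor]
  simp only [← hx, ← hν]
  simp only [← hw]
  simp only [← hV, ← hY, ← hP, ← hD]
  rw [hW, R_add, R_smul, hRD]
  rw [show ((i.cf ^ 2 : ℝ) : ℂ) = ((i.cf : ℝ) : ℂ) * ((i.cf : ℝ) : ℂ) by push_cast; ring]
  simp only [Complex.ofReal_sub]
  module

/-- **INPUT OF THE `∇*_μ`-PART OF `([h]D)(D*Λ)`**: `dFwd_μ(⟨y′,ν′⟩) = −c_f(∂⁻_{ν′}h)(x′+e_{ν′})•(T_{ν′}Λ_μ)(x′)` (the forward difference of `h` along the bond's own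
direction against the transported `μ`-component). [cite: Balaban1985BackgroundPropagators, (3.100) p.413, (3.3) p.390] -/
def dFwd (μ : Fin (d + 1)) : FBondY i → 𝔸 := fun b =>
  -(((i.cf : ℝ) : ℂ) • (((dg i h b.dir (shiftY i b.dir (chartY i b.src)) : ℝ) : ℂ) • fwdT i U b.dir (bondCompY i μ Λ) (chartY i b.src)))

/-- **REMAINDER `zMixF`**: `zMixF_μ(⟨y,ν⟩) = −c_f²((∂⁻_νh)(x+e_ν) − (∂⁻_νh)(x−e_μ+e_ν))•R(U_μ(x−e_μ))⁻¹(T_νΛ_μ)(x−e_μ)` (mixed second difference of `h`).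
[cite: Balaban1985BackgroundPropagators, p.414 l.1–2, (3.7) p.391] -/
def zMixF (μ : Fin (d + 1)) : FBondY i → 𝔸 := fun b =>
  -(((i.cf ^ 2 : ℝ) : ℂ) • ((dg i h b.dir (shiftY i b.dir (chartY i b.src)) - dg i h b.dir (shiftY i b.dir ((shiftY i μ).symm (chartY i b.src))) : ℝ) : ℂ) •
      R (UboxY i U μ ((shiftY i μ).symm (chartY i b.src)))⁻¹ (fwdT i U b.dir (bondCompY i μ Λ) ((shiftY i μ).symm (chartY i b.src))))

/-- **REMAINDER `zHolF`**: `zHolF_μ(⟨y,ν⟩) = −c_f²(∂⁻_νh)(x+e_ν)•R(U_μ(w))⁻¹(R(U(∂p_{μν}(w)))Y − Y)`, `w = x − e_μ`, `Y = R(U_ν(w))Λ_μ(w+e_ν)`.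
[cite: Balaban1985BackgroundPropagators, (3.7) p.391, (3.35) p.396, (3.69) p.404] -/
def zHolF (μ : Fin (d + 1)) : FBondY i → 𝔸 := fun b =>
  -(((i.cf ^ 2 : ℝ) : ℂ) • ((dg i h b.dir (shiftY i b.dir (chartY i b.src)) : ℝ) : ℂ) •
      R (UboxY i U μ ((shiftY i μ).symm (chartY i b.src)))⁻¹
        (R (plaqU (shiftY i) (UboxY i U) μ b.dir ((shiftY i μ).symm (chartY i b.src)))
            (R (UboxY i U b.dir ((shiftY i μ).symm (chartY i b.src))) (bondCompY i μ Λ (shiftY i b.dir ((shiftY i μ).symm (chartY i b.src)))))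
          - R (UboxY i U b.dir ((shiftY i μ).symm (chartY i b.src))) (bondCompY i μ Λ (shiftY i b.dir ((shiftY i μ).symm (chartY i b.src))))))

/-- ★★ **PIECE `([h]D_U)(D*_UΛ)` REGROUPED FOR A LEFT FACTOR**: `(([h_B | h]D)D*Λ)(b) = Σ_μ (∇*_{U,μ} dFwd_μ)(b) + Σ_μ (zMixF_μ + zHolF_μ)(b)` — the gradient's
Leibniz remainder `−c_f(h(x+e_ν) − h(x))•R(U_ν(x))(D*Λ)(x+e_ν)`, the divergence `c_fΣ_μ∇*_μΛ_μ` at `x+e_ν` carried back round the corner, the difference of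
`h` moved inside `∇*_μ`. [cite: Balaban1985BackgroundPropagators, (3.3) p.390, (3.8) p.392, (3.7) p.391, (3.100) p.413, p.414 l.1–3] -/
theorem gradComm_div_apply (b : FBondY i) :
    (cutCommR (hBdY i h) h (gradY i U) ∘ₗ divY i U) Λ b
      = (∑ μ : Fin (d + 1), cdsB i U μ (dFwd i h U Λ μ) b) + ∑ μ : Fin (d + 1), (zMixF i h U Λ μ b + zHolF i h U Λ μ b) := by
  obtain ⟨x, hx⟩ : ∃ x : SiteY i, x = chartY i b.src := ⟨_, rfl⟩
  obtain ⟨ν, hν⟩ : ∃ ν : Fin (d + 1), ν = b.dir := ⟨_, rfl⟩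
  -- the gradient's commutator: `c_f•(h(x) − h(x+e_ν))•R(U_ν x)(D*Λ)(x+e_ν)`
  have h1 : (cutCommR (hBdY i h) h (gradY i U) ∘ₗ divY i U) Λ b
      = ((i.cf : ℝ) : ℂ) • (((h x - h (shiftY i ν x) : ℝ) : ℂ) • R (UboxY i U ν x) (divY i U Λ (shiftY i ν x))) := by
    rw [LinearMap.comp_apply, cutCommR_apply, gradY_apply_eq_cdS, gradY_apply_eq_cdS, hBdY_apply, ← hx, ← hν, smul_comm (((h x : ℝ)) : ℂ), ← smul_sub,
      cdS_cutMulY_apply]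
    congr 1
    have e : cdS i U ν (divY i U Λ) x = R (UboxY i U ν x) (divY i U Λ (shiftY i ν x)) - divY i U Λ x := rfl
    rw [e, Complex.ofReal_sub, sub_smul, smul_sub]
    abel
  -- the divergence at `x + e_ν`, transported: per `μ` round the corner
  have h2 : R (UboxY i U ν x) (divY i U Λ (shiftY i ν x))
      = ((i.cf : ℝ) : ℂ) • ∑ μ : Fin (d + 1), R (UboxY i U ν x) (cdsS i U μ (bondCompY i μ Λ) (shiftY i ν x)) := by
    rw [divY_apply_eq_sum_cdsS, R_smul]
    congr 1
    exact map_sum (RL (UboxY i U ν x)) (fun μ => cdsS i U μ (bondCompY i μ Λ) (shiftY i ν x)) Finset.univ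
  have hq : h x - h (shiftY i ν x) = -dg i h ν (shiftY i ν x) := by rw [dg_shiftY]; ring
  rw [h1, h2, hq]
  simp only [Finset.smul_sum, ← Finset.sum_add_distrib]
  refine Finset.sum_congr rfl fun μ _ => ?_
  obtain ⟨w, hw⟩ : ∃ w : SiteY i, w = (shiftY i μ).symm x := ⟨_, rfl⟩
  obtain ⟨V, hV⟩ : ∃ V : 𝔸ˣ, V = UboxY i U μ w := ⟨_, rfl⟩
  obtain ⟨Y, hY⟩ : ∃ Y : 𝔸, Y = R (UboxY i U ν w) (bondCompY i μ Λ (shiftY i ν w)) := ⟨_, rfl⟩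
  obtain ⟨P, hP⟩ : ∃ P : 𝔸ˣ, P = plaqU (shiftY i) (UboxY i U) μ ν w := ⟨_, rfl⟩
  rw [R_cdsS_shift_eq, ← hw, ← hV, ← hY, ← hP]
  -- the cut-off difference inside `∇*_μ`
  have hL := cutMulY_cdsS_eq i U μ (fun z => dg i h ν (shiftY i ν z)) (fwdT i U ν (bondCompY i μ Λ)) x
  rw [cutMulY_apply, ← hw, ← hV] at hL
  have hA : cdsS i U μ (cutMulY (fun z => dg i h ν (shiftY i ν z)) (fwdT i U ν (bondCompY i μ Λ))) x
      = ((dg i h ν (shiftY i ν x) : ℝ) : ℂ) • cdsS i U μ (fwdT i U ν (bondCompY i μ Λ)) x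
        - ((dg i h ν (shiftY i ν x) - dg i h ν (shiftY i ν w) : ℝ) : ℂ) • R V⁻¹ (fwdT i U ν (bondCompY i μ Λ) w) :=
    eq_sub_of_add_eq hL.symm
  have hB : cdsB i U μ (dFwd i h U Λ μ) b
      = -(((i.cf : ℝ) : ℂ) • (((i.cf : ℝ) : ℂ) • cdsS i U μ (cutMulY (fun z => dg i h ν (shiftY i ν z)) (fwdT i U ν (bondCompY i μ Λ))) x)) := by
    have hc : bondCompY i ν (dFwd i h U Λ μ) = fun z => -((i.cf : ℝ) : ℂ) • cutMulY (fun z => dg i h ν (shiftY i ν z)) (fwdT i U ν (bondCompY i μ Λ)) z := by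
      funext z
      rw [bondCompY_apply, cutMulY_apply, neg_smul]
      show dFwd i h U Λ μ ⟨(chartY i).symm z, ν⟩ = _
      unfold dFwd
      rw [Equiv.apply_symm_apply]
    rw [cdsB_eq_cdsS_bondCompY, ← hν, ← hx, hc, cdsS_smul_apply, neg_smul, smul_neg]
  rw [hB, hA]
  simp only [zMixF, zHolF]
  simp only [← hx, ← hν]
  simp only [← hw]
  simp only [← hV, ← hY, ← hP]
  rw [show ((i.cf ^ 2 : ℝ) : ℂ) = ((i.cf : ℝ) : ℂ) * ((i.cf : ℝ) : ℂ) by push_cast; ring]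
  simp only [Complex.ofReal_sub, Complex.ofReal_neg]
  module

end Pieces

/-! ## §5 ★★ `K(h)(U)Λ` regrouped for an operator acting on its left -/

/-- ★★ **`K(h)(U)Λ` REGROUPED FOR A LEFT FACTOR** — the bond-sector twin of `B9Thm37TransposedCommutator.KhY_apply_transposed`: at every bond `b`,
`(K(h)(U)Λ)(b) = Σ_μ ∇*_{U,μ}(dCurl_μ)(b) + Σ_μ ∇*_{U,μ}(J_μ dDiv)(b) + Σ_μ ∇*_{U,μ}(dMul_μ)(b) + Σ_μΣ_λ ∇*_{U,λ}(J_λ dBwd_μ)(b) + Σ_μ ∇*_{U,μ}(dFwd_μ)(b)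
  + Σ_μ (zSec_μ + zMixB_μ + zHolB_μ + zJor_μ + zMixF_μ + zHolF_μ)(b) + ([h, Δ′₂(U)]Λ)(b) + ([h, Q*_UaQ_U]Λ)(b)` —
every componentwise adjoint derivative `∇*_{U,μ}` (def-Y's `cdsB`, the letter of (3.42)₃ `G∇*_U`) acts on an EXPLICIT bond function that is zeroth order in `Λ`
and carries one difference of `h`; every other term is zeroth order in `Λ` and carries a second difference of `h`, or one difference of `h` times a plaquette
defect (`R(U(∂p)) − 1`, `𝒦 − 1`, `Im U(∂p)` inside `Δ′₂`), or the averaging commutators of (3.102)–(3.103).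
[cite: Balaban1985BackgroundPropagators, (3.104) p.414, (3.100)–(3.103) pp.413–414, (3.9)–(3.10) p.392, (3.7) p.391, p.398, p.415] -/
theorem KhBY_apply_transposed (h : SiteY i → ℝ) (parB : BondParY 𝔸 i) (U : CfgY 𝔸 i) (Λ : FBondY i → 𝔸) (b : FBondY i) :
    KhBY i h parB U Λ b
      = (∑ μ : Fin (d + 1), cdsB i U μ (dCurl i h U Λ μ) b)
        + (∑ μ : Fin (d + 1), cdsB i U μ (Jb i U μ (dDiv i h U Λ)) b)
        + (∑ μ : Fin (d + 1), cdsB i U μ (dMul i h Λ μ) b)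
        + (∑ μ : Fin (d + 1), ∑ lam : Fin (d + 1), cdsB i U lam (Jb i U lam (dBwd i h U Λ μ)) b)
        + (∑ μ : Fin (d + 1), cdsB i U μ (dFwd i h U Λ μ) b)
        + (∑ μ : Fin (d + 1), (zSec i h U Λ μ b + zMixB i h U Λ μ b + zHolB i h U Λ μ b + zJor i h U Λ μ b + zMixF i h U Λ μ b + zHolF i h U Λ μ b))
        + cutCommR (hBdY i h) (hBdY i h) (curv2Y i U) Λ b
        + cutCommR (hBdY i h) (hBdY i h) (QsY i parB U ∘ₗ aY i ∘ₗ QY i parB U) Λ b := by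
  rw [KhBY_eq_four, cutCommR_coCurl_jordan_curl, cutCommR_gradY_divY]
  simp only [LinearMap.add_apply, Pi.add_apply]
  rw [coCurlComm_jordan_curl_apply, coCurl_jordan_curlComm_apply, gradComm_div_apply, grad_divComm_apply]
  have e : ∑ μ : Fin (d + 1), (zSec i h U Λ μ b + zMixB i h U Λ μ b + zHolB i h U Λ μ b + zJor i h U Λ μ b + zMixF i h U Λ μ b + zHolF i h U Λ μ b)
      = (∑ μ : Fin (d + 1), (zSec i h U Λ μ b + zMixB i h U Λ μ b + zHolB i h U Λ μ b + zJor i h U Λ μ b))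
        + ∑ μ : Fin (d + 1), (zMixF i h U Λ μ b + zHolF i h U Λ μ b) := by
    rw [← Finset.sum_add_distrib]
    refine Finset.sum_congr rfl fun μ _ => ?_
    abel
  rw [e]
  abel

end Literature.MathematicalPhysics.QuantumFieldTheory.Balaban1983to89.B9Thm310TransposedCommutatorBForms

end
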